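import Summits.CriticalPhenomena.CardyFormulaZ2.Theorems.CardyIKTransportIKLinearTransportWallDominationRingDefs
import Summits.CriticalPhenomena.CardyFormulaZ2.Theorems.CardyIKTransportIKLinearTransportWallDominationBoxRead

/-!
# `CardyIKTransport.IKLinearTransport` (stmt-CriticalPhenomena-5076), line `pinned-diagram-exchange`, lead c8 —
# WALL DOMINATION, planar transfer (VOCABULARY): thin rings around wall segments in the plane for the ISOTROPIC model

Definitions-only support file (`--supports stmt-CriticalPhenomena-5076`).  Nothing is asserted: every `def … : Prop` is a statement the
LINE POSITS (a registered sub-goal of `stub_ringAll`); the composition is in the sibling assembly file (lead), sorry-free.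

THE TARGET (a fragment of `stub_ringAll` at `S = univ`, in the regime "thin box, thick neighbourhood"): there are `N, j, c > 0` such that
for every `s ≥ N` and every position, with `ν_univ`-probability `≥ c` no WHITE path meeting the wall segment `{a} × [b, b+s)` reaches
sup-distance `2M + 3s` from it, `M = (2j+1)(s+1)` — a black circuit around the segment inside a neighbourhood of bounded aspect, for the
isotropic Izergin–Korepin cell model WITHOUT positive association.

THE ROUTE (lead c8 report §3/§5 and NOTES "wave-3 design").  On the cylinder slab of `s + s` face columns and circumference
`L = 2M + 7s + 1` read as bottom margin `[0,M)` · lower window `B = [M,M+s)` · core `[M+s,M+2s)` · upper window `A = [M+2s,M+3s)` · top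
margin `[M+3s,2M+3s)` · off-band (`4s+1` rows): the chained thin-ring event `thinRingChain s s A B` has probability `≥ c₀` for EVERY pattern
(`thinRingChain_margin_all`: two-wall domination + site-`𝕋`).  Either all its realising black paths stay inside the band rows — then the
band part of the configuration lies in the planar box event `ThinRingQ` (`ThinRingCylSubset`) — or some black path of a half-slab leaves the
band from the windows, which forces a bottom–top crossing of one of the four `(s+1) × M` margin boxes (`ExitCyl`), a band event whose slab
probability is at most twice its planar probability (`CylPlane.cylProb_bandQ_le`), i.e. twice a HARD crossing probability of the isotropic
model, `≤ ((1+η)/2)^j` (`pureIK_hardCrossing_decay_tb`, p149831).  The planar probability of `ThinRingQ` is at least half its slab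
probability (`cylProb_bandQ_le` again), equals the `ν_univ`-probability of the planar event `ThinRingObs` (`nuMix_boxReadQ_eq_qProb` p157161 +
`ThinRingQ_planar`), which is translation invariant (`ThinRingObs_shift`) and is contained in the ring event of the core segment by the
lattice Jordan lemma `thetaEnclosureChain` (`ThinRingObs_ring`).

Contents: §1 planar regions and the events `BlackPathIn`, `ThinRingObs`, `RingSeg` · §2 the box-level events `ThinRingQ`, `MarginQ`, the
slab event `ExitCyl` · §3 the sub-goal statements `ThinRingCylSubset`, `ThinRingQ_planar`, `MarginQ_planar`, `ThinRingObs_shift`,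
`ThinRingObs_ring` · §4 registered names.
-/

noncomputable section

namespace Summit.CriticalPhenomena.CardyFormulaZ2.Theorems.IKLinearTransport.PinnedDiagramExchange.WallDomination

open scoped BigOperators Classical
open Summit.CriticalPhenomena.CardyFormulaZ2.Cruxes.IKMixedBoxCrossing.DefectClosureExploration
open Summit.CriticalPhenomena.CardyFormulaZ2.Theorems.IKLinearTransport.PinnedDiagramExchange (Obs monoPaths farFrom cellGraph tbCross νmix)
open Literature.Probability.LatticeModels (Site)

/-! ## §1 Planar regions and events (anchor `(a₀, b₀)` = planar cell of the slab cell `(0, row 0)`; wall column `a₀ + s`) -/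

/-- A BLACK path of the observable configuration `x` inside the region `R` from the cell `c` to the cell `d` (chain form, as in
`monoPaths`). -/
def BlackPathIn (x : Obs) (R : Set (Site 2)) (c d : Site 2) : Prop :=
  ∃ p : List (Site 2), List.IsChain (cellGraph x.2).Adj p ∧ p.head? = some c ∧ p.getLast? = some d ∧ ∀ v ∈ p, v ∈ x.1 ∧ v ∈ R

/-- The RIGHT part of the planar band box: columns `[a₀+s, a₀+2s]`, rows `[b₀, b₀+2M+3s)`. -/
def rightRegion (a₀ b₀ : ℤ) (s M : ℕ) : Set (Site 2) :=
  {v | a₀ + s ≤ v 0 ∧ v 0 ≤ a₀ + 2 * s ∧ b₀ ≤ v 1 ∧ v 1 < b₀ + 2 * M + 3 * s}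

/-- The LEFT part of the planar band box: columns `[a₀, a₀+s]`, rows `[b₀, b₀+2M+3s)`. -/
def leftRegion (a₀ b₀ : ℤ) (s M : ℕ) : Set (Site 2) :=
  {v | a₀ ≤ v 0 ∧ v 0 ≤ a₀ + s ∧ b₀ ≤ v 1 ∧ v 1 < b₀ + 2 * M + 3 * s}

/-- Rows of the upper window `A = [b₀+M+2s, b₀+M+3s)`. -/
def rowsA (b₀ : ℤ) (s M : ℕ) : Set ℤ := {y | b₀ + M + 2 * s ≤ y ∧ y < b₀ + M + 3 * s}

/-- Rows of the lower window `B = [b₀+M, b₀+M+s)`. -/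
def rowsB (b₀ : ℤ) (s M : ℕ) : Set ℤ := {y | b₀ + M ≤ y ∧ y < b₀ + M + s}

/-- The wall cell of row `y` (wall column `a₀ + s`). -/
def wallCell (a₀ : ℤ) (s : ℕ) (y : ℤ) : Site 2 := ![a₀ + s, y]

/-- THE PLANAR CHAINED THIN-RING EVENT: wall rows `u, u' ∈ A`, `v, v' ∈ B`; a black path inside the right part from the wall cell of `u`
to that of `v`, one inside the left part from `u'` to `v'`; `u'` chained to `u` through wall rows of `A`, `v'` to `v` through wall rows of
`B`, each link a black path inside the left part or inside the right part. -/
def ThinRingObs (a₀ b₀ : ℤ) (s M : ℕ) : Set Obs :=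
  {x | ∃ u ∈ rowsA b₀ s M, ∃ u' ∈ rowsA b₀ s M, ∃ v ∈ rowsB b₀ s M, ∃ v' ∈ rowsB b₀ s M,
    BlackPathIn x (rightRegion a₀ b₀ s M) (wallCell a₀ s u) (wallCell a₀ s v) ∧
    BlackPathIn x (leftRegion a₀ b₀ s M) (wallCell a₀ s u') (wallCell a₀ s v') ∧
    Relation.ReflTransGen (fun y y' => y ∈ rowsA b₀ s M ∧ y' ∈ rowsA b₀ s M ∧
      (BlackPathIn x (leftRegion a₀ b₀ s M) (wallCell a₀ s y) (wallCell a₀ s y') ∨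
        BlackPathIn x (rightRegion a₀ b₀ s M) (wallCell a₀ s y) (wallCell a₀ s y'))) u' u ∧
    Relation.ReflTransGen (fun y y' => y ∈ rowsB b₀ s M ∧ y' ∈ rowsB b₀ s M ∧
      (BlackPathIn x (leftRegion a₀ b₀ s M) (wallCell a₀ s y) (wallCell a₀ s y') ∨
        BlackPathIn x (rightRegion a₀ b₀ s M) (wallCell a₀ s y) (wallCell a₀ s y'))) v' v}

/-- THE RING EVENT OF A WALL SEGMENT (the ring clause of `stub_IKFarRSW`/`stub_ringAll` for the width-`1` box `{a} × [b, b+s)` with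
neighbourhood distance `n`): no white monochromatic path meeting the segment reaches `farFrom a b 1 s n`. -/
def RingSeg (a b : ℤ) (s n : ℕ) : Set Obs :=
  {x | ∀ p ∈ monoPaths x false, (∃ u ∈ p, a ≤ u 0 ∧ u 0 < a + 1 ∧ b ≤ u 1 ∧ u 1 < b + s) → ∀ v ∈ p, v ∉ farFrom a b 1 s n}

/-! ## §2 Box-level events (band box of the slab of `s + s` face columns and `2M + 3s` rows, at the origin) and the exit event -/

/-- The band box version of the thin-ring event: box configurations whose observables (`CylPlane.obsQ`, box at the origin) lie in
`ThinRingObs 0 0 s M`. -/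
def ThinRingQ (s M : ℕ) : Set (CylPlane.Q (s + s) (2 * M + 3 * s - 1)) :=
  {q | CylPlane.obsQ q ∈ ThinRingObs 0 0 s M}

/-- The lower-left corners of the four MARGIN BOXES (each `(s+1)` cells wide and `M` rows tall): right-bottom, right-top, left-bottom,
left-top. -/
def marginCorner (s M : ℕ) (i : Fin 4) : ℤ × ℤ :=
  ![((s : ℤ), (0 : ℤ)), ((s : ℤ), ((M + 3 * s : ℕ) : ℤ)), ((0 : ℤ), (0 : ℤ)), ((0 : ℤ), ((M + 3 * s : ℕ) : ℤ))] i

/-- The band box version of "the `i`-th margin box is crossed bottom-to-top by a black path" (read through `CylPlane.obsQ`). -/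
def MarginQ (s M : ℕ) (i : Fin 4) : Set (CylPlane.Q (s + s) (2 * M + 3 * s - 1)) :=
  {q | CylPlane.obsQ q ∈ tbCross (marginCorner s M i).1 (marginCorner s M i).2 (s + 1) M}

/-- THE EXIT EVENT of the slab: the band part shows a bottom–top crossing of one of the four margin boxes. -/
def ExitCyl (s M L : ℕ) : Set (CylCfg (s + s) L) :=
  ⋃ i : Fin 4, (CylPlane.bandQ L (2 * M + 3 * s - 1) : CylCfg (s + s) L → CylPlane.Q (s + s) (2 * M + 3 * s - 1)) ⁻¹' MarginQ s M i

/-! ## §3 The sub-goal statements -/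

/-- CYLINDER SIDE · on the slab of `s + s` face columns and circumference `L = 2M + 7s + 1`, the chained thin-ring event with windows
`A = [M+2s, M+3s)`, `B = [M, M+s)` is contained in "the band part lies in `ThinRingQ`" union the exit event (a realising black path of a
half-slab that leaves the band rows `[0, 2M+3s)` from the windows crosses a margin box bottom-to-top inside that half: discrete intermediate
values; paths staying in the band are box paths of the observables of the band, `CylPlane.blackEdges_of_adj` pattern).
  A statement to be proved (registered sub-goal), not asserted here. -/
def ThinRingCylSubset : Prop :=
  ∀ (s M L : ℕ) [NeZero L], 1 ≤ s → L = 2 * M + 7 * s + 1 →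
    thinRingChain s s {r : ZMod L | M + 2 * s ≤ r.val ∧ r.val < M + 3 * s} {r : ZMod L | M ≤ r.val ∧ r.val < M + s} ⊆
      (CylPlane.bandQ L (2 * M + 3 * s - 1) : CylCfg (s + s) L → CylPlane.Q (s + s) (2 * M + 3 * s - 1)) ⁻¹' ThinRingQ s M ∪
        ExitCyl s M L

/-- PLANAR SIDE, THIN RING · the planar configurations whose box reading lies in `ThinRingQ` are exactly those in `ThinRingObs 0 0 s M`
(paths inside the box region only read the colours of box cells and the flags of inner faces; `CylPlane.obsQ ∘ boxReadQ` agrees with the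
configuration there).
  A statement to be proved (registered sub-goal), not asserted here. -/
def ThinRingQ_planar : Prop :=
  ∀ (s M : ℕ), 1 ≤ s → {x : Obs | boxReadQ (s + s) (2 * M + 3 * s - 1) x ∈ ThinRingQ s M} = ThinRingObs 0 0 s M

/-- PLANAR SIDE, MARGINS · likewise for the four margin crossings: the planar configurations whose box reading lies in `MarginQ s M i` are
exactly the bottom–top crossings `tbCross` of the `i`-th margin box (a sub-box of the band box).
  A statement to be proved (registered sub-goal), not asserted here. -/
def MarginQ_planar : Prop :=
  ∀ (s M : ℕ), 1 ≤ s → ∀ i : Fin 4,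
    {x : Obs | boxReadQ (s + s) (2 * M + 3 * s - 1) x ∈ MarginQ s M i} =
      tbCross (marginCorner s M i).1 (marginCorner s M i).2 (s + 1) M

/-- TRANSLATION INVARIANCE of the isotropic law on the thin-ring event.
  A statement to be proved (registered sub-goal), not asserted here. -/
def ThinRingObs_shift : Prop :=
  ∀ (a₀ b₀ : ℤ) (s M : ℕ), (νmix Set.univ).real (ThinRingObs a₀ b₀ s M) = (νmix Set.univ).real (ThinRingObs 0 0 s M)

/-- ENCLOSURE (from the lattice Jordan lemma `thetaEnclosureChain`, p-landed by the wave-c8 worker): a configuration in the thin-ring event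
has no white path from the core wall segment `{a₀+s} × [b₀+M+s, b₀+M+2s)` to sup-distance `2M + 3s`, i.e. lies in the ring event of that
segment.
  A statement to be proved (registered sub-goal), not asserted here. -/
def ThinRingObs_ring : Prop :=
  ∀ (a₀ b₀ : ℤ) (s M : ℕ), 1 ≤ s →
    ThinRingObs a₀ b₀ s M ⊆ RingSeg (a₀ + s) (b₀ + M + s) s (2 * M + 3 * s)

/-! ## §4 Registered names -/

namespace Registered

/-- Alias keyed by the registered sub-goal name (cylinder side). -/
abbrev stub_thinRingCylSubset : Prop := ThinRingCylSubset
/-- Alias keyed by the registered sub-goal name (planar side, thin ring). -/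
abbrev stub_thinRingQ_planar : Prop := ThinRingQ_planar
/-- Alias keyed by the registered sub-goal name (planar side, margins). -/
abbrev stub_marginQ_planar : Prop := MarginQ_planar
/-- Alias keyed by the registered sub-goal name (translation invariance). -/
abbrev stub_thinRingObs_shift : Prop := ThinRingObs_shift
/-- Alias keyed by the registered sub-goal name (enclosure). -/
abbrev stub_thinRingObs_ring : Prop := ThinRingObs_ring

end Registered

/-- The ring event of a segment is monotone in the neighbourhood distance: a larger distance is a weaker requirement. -/
theorem ringSeg_mono : ∀ {a b : ℤ} {s n n' : ℕ}, n ≤ n' → RingSeg a b s n ⊆ RingSeg a b s n' := by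
  intro a b s n n' h x hx p hp hmeet v hv hfar
  refine hx p hp hmeet v hv ?_
  simp only [farFrom, Set.mem_setOf_eq] at hfar ⊢
  push_cast at hfar ⊢
  omega

end Summit.CriticalPhenomena.CardyFormulaZ2.Theorems.IKLinearTransport.PinnedDiagramExchange.WallDomination

end
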